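import Summits.QuantumFields.BalabanUV.Beta.D1BFx.PackedKernelSplit
import Summits.QuantumFields.BalabanUV.Beta.D1BFx.ReducedKernelSandwichLeg

/-!
# `BalabanUV.Beta.FP.FineHessianBlockSplit` — road «FP» for binder row D1, ROW KER-γ (α2) sub-row α2-a PART 1 (owner memo `KER-GAMMA-ALPHA2.md` §1∕§5,
# R-FP-34 + E-FP-9-1): THE `field ⊕ multiplier` BLOCK SPLIT OF THE FULL FINE HESSIAN TABLE — `fineHessA A S Wf` at the bond pair `(κ′,u),(l′,u′)`
# IS the ff (gluon) word on the leg `A_ff` plus `PackedKernelSplit.blockTerms` (the 3 + 15 words with an `ℋ`- or multiplier leg), read at the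
# SHIFTED families — slice-agnostic, for ANY spread packed leg and localised stencils∕tables

HONEST DEPENDENCY (page 1, mandatory): continuum YM on T⁴ ⇐ BetaPertH ∧ nine spine estimates (0/9 proved); BetaPertH ⇐ (D1) ∧ (D4) ∧ CAP+tail;
G-an2-4 gates asym, D1 and NE2/3/4.  HONEST FRAMING (cell contract, verbatim): «discharging `BetaPertH` makes Bałaban's UV stability UNCONDITIONAL —
a real constructive-QFT result; it is NOT the continuum limit and NOT the Clay problem.»  THIS MODULE DISCHARGES NOTHING of the wall: it is [folklore]
bookkeeping BY NAME over road BF-x's `D1BFx/PackedKernelSplit` (`hessKer_eq_ff_add_blockTerms`, `blk`, `ffV`, `ffW`, `blockTerms`) and leaf-01's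
`D1BFx/ReducedKernelSandwichLeg.fineHessA = tadpoleTableA + bubbleTableA`: the two-point table at `(κ′,u),(l′,u′)` is the translation-reduced Hessian
kernel `hessKer` of the `u`-SHIFTED families at the difference `u′ − u` (`fineHessA_eq_hessKer_shift`, definitional up to `0 + u = u`, `(u′−u) + u = u′`),
so the generic split transports verbatim.  No `def`, no `def … : Prop`, nothing cited, 0 sorry; 0∕4 row-D1 binders; NOT (α2) (the MIX identification of
the block terms with the `MixLoopInstanceBlockFamily*` input shapes = α2-a PART 2, the gluon core vs `PiBF` = α2-b), NOT hsplit, NOT D1, NOT BetaPertH,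
NOT continuum, NOT Clay.  «not in print; our bookkeeping».

ABSOLUTE RULE (cell charter, verbatim): «No internally-minted statement may enter as a cited fact. Every hypothesis is either kernel-proved in this package or a
verbatim quotation of a PUBLISHED theorem with page reference. The manuscript(s) under audit are NOT citable for their own disputed steps — they are the thing
under adjudication; programme-internal (2001/route/tribunal) claims are never citable.»

WHY.  The junction socket (α0) (`FineSplitJunction(BiVertex)` ✓, leaf-01-g11) asks for `hfine : fineHessA (axDressK N K_m) (coProj N (S m)) (Wf m) − N⁸·truncK PiBF N
= Σ_i G_i`; the FIRST cut of the left member is by the fibre: the ff word (gluon loop on the leg `A_ff = Π K_ff Π`, E-FP-9-1: the AXIAL co-dressed block) and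
the block terms (the four MIX loops of `KKTSecondVariation.sixLoops_kkt`, to be matched with ne7b-leaf-02-g23's instance shapes in PART 2).

WHAT ([folklore], `d + 1 = 4`, any finite fibre `F`).  §1 `fineHessA_eq_hessKer_shift` (the table IS `hessKer` of the shifted families); **`fineHessA_eq_ff_add_blockTerms`**
(`Spr A`, localised `S κ u`, `Wf κ u l u′` ⟹ `fineHessA A S Wf κ′ l′ u u′ = hessKer (blk A ff) (ffV S^u) (ffW Wf^u) κ′ l′ (u′−u) + blockTerms A S^u Wf^u κ′ l′ (u′−u)`,
`S^u μ y := S μ (y + u)`, `Wf^u μ y ν y′ := Wf μ (y+u) ν (y′+u)`); §2 `fineHessA_blk_eq` (the ff word is itself a `fineHessA` on the fibre `F` with the ff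
blocks of the stencils: `hessKer (blk A ff) (ffV S^u) (ffW Wf^u) κ′ l′ (u′ − u) = fineHessA (blk A ff) (S·ff) (Wf·ff) κ′ l′ u u′`).
Provenance: road FP OWNER b2b-balaban-beta-d1-p3 gen 9 (prover-b2b-balaban-beta-d1-p3-g9-0), 2026-08-21, sub-row α2-a part 1.
-/

noncomputable section

namespace Summit.QuantumFields.BalabanUV.Beta.FP.FineHessianBlockSplit

open Finset
open scoped BigOperators
open Literature.MathematicalPhysics.QuantumFieldTheory.Balaban1983to89
open Literature.MathematicalPhysics.QuantumFieldTheory.Balaban1983to89.Beta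
open ExpKernelCalculus (Site MKer Decays BiLoc comp tr bubble tadpole hessKer)
open Summit.QuantumFields.BalabanUV.Beta.TameKernelCalculus
open Summit.QuantumFields.BalabanUV.Beta.D1BFx.PackedKernelSplit (blk ffV ffW blockTerms hessKer_eq_ff_add_blockTerms blk_tt)
open Summit.QuantumFields.BalabanUV.Beta.D1BFx.DressedTablesLeg (tadpoleTableA bubbleTableA tadpoleTableA_apply bubbleTableA_apply)
open Summit.QuantumFields.BalabanUV.Beta.D1BFx.ReducedKernelSandwichLeg (fineHessA fineHessA_apply)

variable {F : Type*} [Fintype F]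

/-! ## §1 The table is the Hessian kernel of the shifted families; the block split -/

/-- [folklore] **THE FULL FINE HESSIAN TABLE IS `hessKer` OF THE `u`-SHIFTED FAMILIES** at the difference `u′ − u`:
`fineHessA A S Wf κ′ l′ u u′ = hessKer A (μ y ↦ S μ (y + u)) (μ y ν y′ ↦ Wf μ (y+u) ν (y′+u)) κ′ l′ (u′ − u)`. -/
theorem fineHessA_eq_hessKer_shift [Nonempty F] (A : MKer 4 F) (S : Fin 4 → Site 4 → MKer 4 F) (Wf : Fin 4 → Site 4 → Fin 4 → Site 4 → MKer 4 F)
    (κ' l' : Fin 4) (u u' : Site 4) :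
    fineHessA A S Wf κ' l' u u' =
      hessKer A (fun μ y => S μ (y + u)) (fun μ y ν y' => Wf μ (y + u) ν (y' + u)) κ' l' (u' - u) := by
  rw [fineHessA_apply, tadpoleTableA_apply, bubbleTableA_apply]
  simp only [hessKer, zero_add, sub_add_cancel]
  ring

/-- [folklore] **THE `field ⊕ multiplier` BLOCK SPLIT OF THE FULL FINE HESSIAN TABLE** (spread packed leg, localised stencils and tables):
`fineHessA A S Wf κ′ l′ u u′ = hessKer A_ff (S^u·ff) (Wf^u·ff) κ′ l′ (u′−u) + blockTerms A S^u Wf^u κ′ l′ (u′−u)` — `PackedKernelSplit.hessKer_eq_ff_add_blockTerms`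
at the shifted families (`S^u μ y = S μ (y+u)`, `Wf^u μ y ν y′ = Wf μ (y+u) ν (y′+u)`). -/
theorem fineHessA_eq_ff_add_blockTerms [Nonempty F] {A : MKer 4 (F ⊕ F)} (hA : Spr A)
    {S : Fin 4 → Site 4 → MKer 4 (F ⊕ F)} (hS : ∀ κ u, Loc (S κ u))
    {Wf : Fin 4 → Site 4 → Fin 4 → Site 4 → MKer 4 (F ⊕ F)} (hW : ∀ κ u l u', Loc (Wf κ u l u'))
    (κ' l' : Fin 4) (u u' : Site 4) :
    fineHessA A S Wf κ' l' u u' =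
      hessKer (blk A true true) (ffV fun μ y => S μ (y + u)) (ffW fun μ y ν y' => Wf μ (y + u) ν (y' + u)) κ' l' (u' - u)
        + blockTerms A (fun μ y => S μ (y + u)) (fun μ y ν y' => Wf μ (y + u) ν (y' + u)) κ' l' (u' - u) := by
  rw [fineHessA_eq_hessKer_shift]
  exact hessKer_eq_ff_add_blockTerms hA (fun μ y => hS μ (y + u)) (fun μ y ν y' => hW μ (y + u) ν (y' + u)) κ' l' (u' - u)

/-! ## §2 The ff word is the fine Hessian table of the ff data -/

/-- [folklore] **THE GLUON WORD IS ITSELF A FINE HESSIAN TABLE** on the fibre `F`: with the ff blocks of the stencils and tables,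
`hessKer A_ff (S^u·ff) (Wf^u·ff) κ′ l′ (u′−u) = fineHessA A_ff (κ u ↦ blk (S κ u) ff) (κ u l u′ ↦ blk (Wf κ u l u′) ff) κ′ l′ u u′`. -/
theorem hessKer_blk_eq_fineHessA [Nonempty F] (A : MKer 4 (F ⊕ F)) (S : Fin 4 → Site 4 → MKer 4 (F ⊕ F))
    (Wf : Fin 4 → Site 4 → Fin 4 → Site 4 → MKer 4 (F ⊕ F)) (κ' l' : Fin 4) (u u' : Site 4) :
    hessKer (blk A true true) (ffV fun μ y => S μ (y + u)) (ffW fun μ y ν y' => Wf μ (y + u) ν (y' + u)) κ' l' (u' - u)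
      = fineHessA (blk A true true) (fun κ v => blk (S κ v) true true) (fun κ v l v' => blk (Wf κ v l v') true true) κ' l' u u' := by
  rw [fineHessA_eq_hessKer_shift]
  rfl

/-- [folklore] **THE SPLIT IN TABLE FORM**: `fineHessA A S Wf = fineHessA A_ff S_ff Wf_ff + (blockTerms at the shifted families)` entrywise. -/
theorem fineHessA_eq_fineHessA_ff_add_blockTerms [Nonempty F] {A : MKer 4 (F ⊕ F)} (hA : Spr A)
    {S : Fin 4 → Site 4 → MKer 4 (F ⊕ F)} (hS : ∀ κ u, Loc (S κ u))
    {Wf : Fin 4 → Site 4 → Fin 4 → Site 4 → MKer 4 (F ⊕ F)} (hW : ∀ κ u l u', Loc (Wf κ u l u'))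
    (κ' l' : Fin 4) (u u' : Site 4) :
    fineHessA A S Wf κ' l' u u' =
      fineHessA (blk A true true) (fun κ v => blk (S κ v) true true) (fun κ v l v' => blk (Wf κ v l v') true true) κ' l' u u'
        + blockTerms A (fun μ y => S μ (y + u)) (fun μ y ν y' => Wf μ (y + u) ν (y' + u)) κ' l' (u' - u) := by
  rw [fineHessA_eq_ff_add_blockTerms hA hS hW, hessKer_blk_eq_fineHessA]

end Summit.QuantumFields.BalabanUV.Beta.FP.FineHessianBlockSplit

end
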